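import Summits.QuantumAdvantage.QuantumAdvantage.Theorems.CubicForrelationNearExactIsExactTwelveLevelFive930GranularB
import Summits.QuantumAdvantage.QuantumAdvantage.Theorems.CubicForrelationNearExactIsExactTwelveLevelFiveHyperplaneGe2932
import Summits.QuantumAdvantage.QuantumAdvantage.Theorems.CubicForrelationNearExactIsExactTwelveLevelFive930Structure
import Summits.QuantumAdvantage.QuantumAdvantage.Theorems.CubicForrelationNearExactIsExactTwelveQuadSpectrumB

/-!
# Crux `CubicForrelation.NearExactIsExact` (stmt-QuantumAdvantage-14043) — n = 12, a level-5 side AT the boundary rung `Φ ≥ 29/32` with the pair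
  exact off the odd hyperplane and round 1 passed: gen 20's residual structure VERBATIM (`e = σ + 8r`, `Σ r² ≤ 21`, `Ŝ = 64m`,
  `m ∈ {0, ±16, ±32}`, `W_f = 64(−1)^g − 32m − 4r̂`)

Certificate seat `b2b-cforr-cert` (gen 22).  HONEST FRAMING: a kernel-checked structure lemma (standard axioms, no `decide`) about cubic Boolean pairs on
12 bits — `tw20_levelFive_gt2932_residual` (…TwelveLevelFiveResidualGt2932) ported from `Φ > 29/32` to `Φ ≥ 29/32`, with two hypotheses replacing
the two strict inequalities of gen 20: the pair is exact off the odd hyperplane (`u' = 2(−1)^f` wherever `u'` is even; automatic at `Φ > 29/32` by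
`tw20_off_flat_gt2932`) and round 1 of the cascade has passed (`8 ∣ u' − 2(−1)^f − (−1)^D` on the odd set for a quadratic `D` — the second
alternative of `tw22_levelFive_ge2932_round1`, …TwelveLevelFiveRoundOneGe2932).  Everything else survives the boundary: `48·Σ r² ≤ 1024 ⇒ Σ r² ≤ 21`,
straddling 5-flats, granularity, Walsh inversion; the odd hyperplane by `tw22_hyperplane_ge2932`.  Infrastructure for the boundary rung `29/32`
(HOME/b2b-cforr-cert-g22/PLAN-N12-928-EQ.md); NOT summit progress, NO new value of `θ₁₂` claimed here.

References: J. Ax (1964) / R. J. McEliece (1972); MacWilliams–Sloane (1977) Ch. 13 §3, Ch. 15 §2; C. Carlet (2021) §4.1, §5.2.  Everything below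
is proved from Mathlib and the tree; axioms are the standard three.
-/

set_option linter.dupNamespace false -- D-0017: single-problem summit ⇒ `QuantumAdvantage.QuantumAdvantage` by design

noncomputable section

namespace Summit.QuantumAdvantage.QuantumAdvantage.Theorems.CubicForrelation.NearExactIsExact

open Finset
open Literature.Computability.QuantumComplexity
open Literature.Computability.QuantumComplexity.BuzetChailloux (bxor zeroVec bxor_bxor_cancel_left bxor_zeroVec zeroVec_bxor bxor_comm
  bxor_self twist_zeroVec_right twist_bxor_right)
open Literature.Computability.QuantumComplexity.DerivativeWalsh (W sum_W_sq twist_bxor_left card_mul_card_perp)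
open Literature.Computability.QuantumComplexity.Simon (twist_eq_one_or twist_mul_self)

/-! ### The residual structure of a level-5 side at `Φ ≥ 29/32`, exact off the hyperplane, round 1 passed -/

/-- **Structure of a level-5 side at `Φ ≥ 29/32` on 12 bits, exact off the odd hyperplane, after round 1** (see the module docstring): given
a quadratic `D` with `8 ∣ u' − 2(−1)^f − (−1)^D` on the odd set (the second alternative of `tw22_levelFive_ge2932_round1`), the residual
structure of `tw20_levelFive_gt2932_residual` holds verbatim.  Finite-slice statement, NOT summit progress. [this work] -/
theorem tw22_levelFive_ge2932_residual (f g : (Fin (6 + 6) → Bool) → Bool) (hf : IsDegLeFun 3 f) (hg : IsDegLeFun 3 g)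
    (u' : (Fin (6 + 6) → Bool) → ℤ) (hu' : ∀ x, W (fun y => signOf (g y)) x = (2 : ℝ) ^ 5 * (u' x : ℝ))
    (hodd : ∃ x, Odd (u' x)) (hΦ : (29 / 32 : ℝ) ≤ forrelation f g)
    (hoff : ∀ y, ¬ Odd (u' y) → u' y = 2 * sZ (f y))
    (D : (Fin (6 + 6) → Bool) → Bool) (hD : IsDegLeFun 2 D) (h8 : ∀ x, Odd (u' x) → (8 : ℤ) ∣ u' x - 2 * sZ (f x) - sZ (D x)) :
    ∃ (γ : Fin (6 + 6) → Bool) (tg : ℝ) (r m : (Fin (6 + 6) → Bool) → ℤ),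
      (tg = 1 ∨ tg = -1) ∧ γ ≠ zeroVec ∧ (∀ x, (Odd (u' x) ↔ twist γ x = tg)) ∧
      (∀ x, ¬ Odd (u' x) → r x = 0) ∧
      (∀ x, u' x = 2 * sZ (f x) + (if Odd (u' x) then sZ (D x) + 8 * r x else 0)) ∧
      (∑ x, r x ^ 2 ≤ 21) ∧
      (∀ y, |∑ x, (r x : ℝ) * twist x y| ≤ 21) ∧
      (∑ y, (∑ x, (r x : ℝ) * twist x y) ^ 2 ≤ 86016) ∧
      (∀ y, m y = 0 ∨ |m y| = 16 ∨ |m y| = 32) ∧ (∃ y, m y ≠ 0) ∧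
      (∀ y, ∑ x ∈ univ.filter (fun x : Fin (6 + 6) → Bool => twist γ x = tg), (sZ (D x) : ℝ) * twist x y = 64 * (m y : ℝ)) ∧
      (∀ y, W (fun x => signOf (f x)) y = 64 * signOf (g y) - 32 * (m y : ℝ) - 4 * ∑ x, (r x : ℝ) * twist x y) ∧
      forrelation f g < 1 := by
  classical
  -- `u = 2u'` at the Ax level `4`; residual `e = u' − 2s`, budget `B = Σ e² = 2¹⁵(1 − Φ) ≤ 3072`
  set u : (Fin (6 + 6) → Bool) → ℤ := fun x => 2 * u' x with hudef
  have hu : ∀ x, W (fun y => signOf (g y)) x = (2 : ℝ) ^ 4 * (u x : ℝ) := by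
    intro x; rw [hu' x]; simp only [u]; push_cast; ring
  set e : (Fin (6 + 6) → Bool) → ℤ := fun x => u' x - 2 * sZ (f x) with hedef
  have hbud := tw12_budget f g u hu
  have h4e : ∀ x, (u x - 4 * sZ (f x)) ^ 2 = 4 * e x ^ 2 := fun x => by simp only [u, e]; ring
  have hBR : ((∑ x, e x ^ 2 : ℤ) : ℝ) = 32768 * (1 - forrelation f g) := by
    have h' : ((∑ x, (u x - 4 * sZ (f x)) ^ 2 : ℤ) : ℝ) = 4 * ((∑ x, e x ^ 2 : ℤ) : ℝ) := by
      rw [sum_congr rfl fun x _ => h4e x, ← mul_sum]; push_cast; ring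
    rw [h'] at hbud
    linarith
  have hB_le : (∑ x, e x ^ 2 : ℤ) ≤ 3072 := by
    have h' : ((∑ x, e x ^ 2 : ℤ) : ℝ) ≤ 3072 := by rw [hBR]; linarith
    exact_mod_cast h'
  -- off the hyperplane the pair is exact (hypothesis `hoff`)
  have he0 : ∀ y, ¬ Odd (u' y) → e y = 0 := fun y hy => by
    show u' y - 2 * sZ (f y) = 0
    rw [hoff y hy]; ring
  -- the odd hyperplane `P = x₀ ⊕ V` and the quadratic digit `D`
  obtain ⟨γ, tg, htg, hγ0, hPg⟩ := tw22_hyperplane_ge2932 f g hg u' hu' hodd hΦ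
  set P := univ.filter (fun x : Fin (6 + 6) → Bool => Odd (u' x)) with hPdef
  have hmemP : ∀ x, x ∈ P ↔ Odd (u' x) := fun x => by simp [hPdef]
  have hmemP' : ∀ x, x ∈ P ↔ twist γ x = tg := fun x => by rw [hmemP, hPg]
  set V := univ.filter (fun a : Fin (6 + 6) → Bool => twist γ a = 1) with hVdef
  have hVmem : ∀ a, a ∈ V ↔ twist γ a = 1 := fun a => by rw [hVdef, mem_filter]; simp
  have hV0 : zeroVec ∈ V := (hVmem _).2 (twist_zeroVec_right γ)
  have hVadd : ∀ x ∈ V, ∀ y ∈ V, bxor x y ∈ V := by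
    intro x hx y hy; rw [hVmem] at hx hy ⊢; rw [twist_bxor_right, hx, hy, mul_one]
  have hVcard : #V = 2 ^ 11 := by rw [hVdef, tw59_card_half γ hγ0 1 (Or.inl rfl)]; norm_num
  obtain ⟨x₀, hx₀⟩ := id hodd
  have hx₀P : x₀ ∈ P := (hmemP x₀).2 hx₀
  have hPimg : P = V.image (bxor x₀) := tw59_eq_image P V γ tg hmemP' hVmem x₀ hx₀P
  have hPV : ∀ x, x ∈ P → ∀ a ∈ V, bxor x a ∈ P := fun x hx a ha => fl1_coset_vadd hVadd hPimg hx ha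
  have hcardP : #P = 2048 := by
    have e1 : P = univ.filter (fun x : Fin (6 + 6) → Bool => twist γ x = tg) := by
      ext x; rw [hmemP', mem_filter]; simp
    rw [e1]; exact tw59_card_half γ hγ0 tg htg
  -- cost accounting on `P`
  have heodd : ∀ x, x ∈ P → Odd (e x) := by
    intro x hx
    exact Int.odd_sub.2 (iff_of_true ((hmemP x).1 hx) ⟨sZ (f x), two_mul _⟩)
  have hsq1 : ∀ x, x ∈ P → 1 ≤ e x ^ 2 := by
    intro x hx
    have h0 := Int.odd_iff.1 (heodd x hx)
    have : e x ≤ -1 ∨ 1 ≤ e x := by omega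
    have := tp_sq_ge (k := 1) (by norm_num) this
    linarith
  have hsplit : (∑ x, e x ^ 2 : ℤ) = ∑ x ∈ P, e x ^ 2 :=
    (sum_subset (subset_univ P) fun x _ hx => by
      rw [he0 x (fun h => hx ((hmemP x).2 h))]; ring).symm
  have hPsum : ∑ x ∈ P, e x ^ 2 ≤ 3072 := by rw [← hsplit]; exact hB_le
  -- flat sums of `e = u' − 2s`: `8 ∣` on 5-flats, `16 ∣` on 7-flats, `32 ∣` on 10-flats
  have hflat : ∀ (k c : ℕ) (M : ℤ), (2 : ℤ) ^ (c + 1) = 2 * M → 4 + (c + 1) ≤ k + (6 + 6 - k + 2) / 3 → M ∣ 2 * 2 ^ ((k + 2) / 3) →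
      ∀ (b : Fin (6 + 6) → Bool) (a : Fin k → Fin (6 + 6) → Bool),
      M ∣ ∑ ε : Fin k → Bool, e (fun j => b j ^^ decide (Odd #(univ.filter fun i => ε i && a i j))) := by
    intro k c M hM hk hM' b a
    have h1 := fs_flat_sum_dvd (e := c + 1) g u hg hu b a hk
    obtain ⟨zf, hzf⟩ := sl_sum_sZ_flat f hf b a
    have hzf' : ∑ ε : Fin k → Bool, 2 * sZ (f (fun j => b j ^^ decide (Odd #(univ.filter fun i => ε i && a i j)))) =
        2 * 2 ^ ((k + 2) / 3) * zf := by
      rw [← mul_sum, hzf, ← mul_assoc]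
    have h1' : 2 * M ∣ 2 * ∑ ε : Fin k → Bool, u' (fun j => b j ^^ decide (Odd #(univ.filter fun i => ε i && a i j))) := by
      rw [← hM, mul_sum]; exact h1
    have h1'' : M ∣ ∑ ε : Fin k → Bool, u' (fun j => b j ^^ decide (Odd #(univ.filter fun i => ε i && a i j))) :=
      (mul_dvd_mul_iff_left two_ne_zero).1 h1'
    have h3 : ∑ ε : Fin k → Bool, e (fun j => b j ^^ decide (Odd #(univ.filter fun i => ε i && a i j))) =
        ∑ ε : Fin k → Bool, u' (fun j => b j ^^ decide (Odd #(univ.filter fun i => ε i && a i j))) -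
        ∑ ε : Fin k → Bool, 2 * sZ (f (fun j => b j ^^ decide (Odd #(univ.filter fun i => ε i && a i j)))) := by
      rw [← sum_sub_distrib]
    rw [h3, hzf']
    exact dvd_sub h1'' (dvd_mul_of_dvd_left hM' _)
  have hflat5 := hflat 5 3 8 (by norm_num) (by norm_num) (by norm_num)
  -- flat sums of the quadratic sign `σ = (−1)^D`: `8 ∣`, `16 ∣`, `32 ∣`
  have hquad5 : ∀ (b : Fin (6 + 6) → Bool) (a : Fin 5 → Fin (6 + 6) → Bool),
      (8 : ℤ) ∣ ∑ ε : Fin 5 → Bool, sZ (D (fun j => b j ^^ decide (Odd #(univ.filter fun i => ε i && a i j)))) := by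
    intro b a; have h := tw15_quad_flat_sum D hD b a; rw [show (2 : ℤ) ^ ((5 + 1) / 2) = 8 by norm_num] at h; exact h
  -- combined: the flat sums of `e − σ`
  have hcomb : ∀ (k : ℕ) (M : ℤ),
      (∀ (b : Fin (6 + 6) → Bool) (a : Fin k → Fin (6 + 6) → Bool),
        M ∣ ∑ ε : Fin k → Bool, e (fun j => b j ^^ decide (Odd #(univ.filter fun i => ε i && a i j)))) →
      (∀ (b : Fin (6 + 6) → Bool) (a : Fin k → Fin (6 + 6) → Bool),
        M ∣ ∑ ε : Fin k → Bool, sZ (D (fun j => b j ^^ decide (Odd #(univ.filter fun i => ε i && a i j))))) →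
      ∀ (b : Fin (6 + 6) → Bool) (a : Fin k → Fin (6 + 6) → Bool),
        M ∣ ∑ ε : Fin k → Bool, (e (fun j => b j ^^ decide (Odd #(univ.filter fun i => ε i && a i j))) -
          sZ (D (fun j => b j ^^ decide (Odd #(univ.filter fun i => ε i && a i j))))) := by
    intro k M he hD' b a
    rw [sum_sub_distrib]
    exact dvd_sub (he b a) (hD' b a)
  have hcomb5 := hcomb 5 8 hflat5 hquad5
  -- on `P`: `4 ∣ e − σ`
  have hr1 : ∀ x, x ∈ P → (8 : ℤ) ∣ e x - sZ (D x) := fun x hx => h8 x ((hmemP x).1 hx)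
  have hdig4 : ∀ x, x ∈ P → (4 : ℤ) ∣ e x - sZ (D x) := fun x hx => (show (4 : ℤ) ∣ 8 by norm_num).trans (hr1 x hx)
  -- ONE ROUND of wild-point parity on `P`: if `q ∣ e − σ` on `P`, the flat layer gives `2q ∣` on flats, and odd quotients are
  -- too expensive, then `2q ∣ e − σ` on `P`
  have hsumP : ∑ x ∈ P, (e x ^ 2 - 1) ≤ 1024 := by
    have h3 : ∑ x ∈ P, (e x ^ 2 - 1) = ∑ x ∈ P, e x ^ 2 - 2048 := by
      rw [sum_sub_distrib, sum_const, hcardP]; norm_num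
    linarith
  /- NEW (gen 20): the function `r = (e − σ)/8` on `P` -/
  set r : (Fin (6 + 6) → Bool) → ℤ := fun x => if x ∈ P then (e x - sZ (D x)) / 8 else 0 with hrdef
  have hrP : ∀ x, x ∈ P → e x = sZ (D x) + 8 * r x := by
    intro x hx
    simp only [r, if_pos hx]
    have := Int.mul_ediv_cancel' (hr1 x hx)
    linarith
  have hroff : ∀ x, x ∉ P → r x = 0 := fun x hx => by simp only [r, if_neg hx]
  -- cost: `e² − 1 = 16 r (4r + σ) ≥ 48 r²` on `P`
  have hcost48 : ∀ x, x ∈ P → 48 * r x ^ 2 ≤ e x ^ 2 - 1 := by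
    intro x hx
    rw [hrP x hx]
    have habs : |r x| ≤ r x ^ 2 := by
      rcases le_or_gt 0 (r x) with h | h
      · rw [abs_of_nonneg h]; nlinarith
      · rw [abs_of_neg h]; nlinarith
    rcases tp_sZ_cases (D x) with hs | hs <;> rw [hs]
    · nlinarith [abs_le.1 habs |>.1, abs_le.1 habs |>.2, le_abs_self (r x), neg_abs_le (r x)]
    · nlinarith [abs_le.1 habs |>.1, abs_le.1 habs |>.2, le_abs_self (r x), neg_abs_le (r x)]
  have hr20 : ∑ x, r x ^ 2 ≤ 21 := by
    have hsplitr : ∑ x, r x ^ 2 = ∑ x ∈ P, r x ^ 2 := by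
      refine (sum_subset (subset_univ P) fun x _ hx => ?_).symm
      rw [hroff x hx]; ring
    have h1 : 48 * ∑ x ∈ P, r x ^ 2 ≤ ∑ x ∈ P, (e x ^ 2 - 1) := by
      rw [mul_sum]; exact sum_le_sum fun x hx => hcost48 x hx
    rw [hsplitr]; omega
  -- `r̂`
  have hrabs : ∀ y, |∑ x, (r x : ℝ) * twist x y| ≤ 21 := by
    intro y
    calc |∑ x, (r x : ℝ) * twist x y| ≤ ∑ x, |(r x : ℝ) * twist x y| := abs_sum_le_sum_abs _ _
      _ = ∑ x, |(r x : ℝ)| := sum_congr rfl fun x _ => by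
          rw [abs_mul]; rcases twist_eq_one_or x y with h | h <;> rw [h] <;> simp
      _ ≤ ∑ x, ((r x : ℝ)) ^ 2 := sum_le_sum fun x _ => by
          rw [← Int.cast_abs]
          have habs : |r x| ≤ r x ^ 2 := by
            rcases le_or_gt 0 (r x) with h | h
            · rw [abs_of_nonneg h]; nlinarith
            · rw [abs_of_neg h]; nlinarith
          exact_mod_cast habs
      _ ≤ 21 := by
          have : ((∑ x, r x ^ 2 : ℤ) : ℝ) ≤ 21 := by exact_mod_cast hr20
          push_cast at this; exact this
  have hrpars : ∑ y, (∑ x, (r x : ℝ) * twist x y) ^ 2 ≤ 86016 := by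
    have h := sum_W_sq (n := 6 + 6) (fun x => (r x : ℝ))
    unfold W at h
    rw [h]
    have : ((∑ x, r x ^ 2 : ℤ) : ℝ) ≤ 21 := by exact_mod_cast hr20
    push_cast at this
    norm_num
    linarith
  /- NEW (gen 20): straddling 5-flats ⇒ all 4-flat sums of `σ` inside `P` are `≡ 0 (mod 8)` -/
  obtain ⟨v₀, hv₀⟩ := es_exists_twist_neg hγ0
  have hv₀V : v₀ ∉ V := by rw [hVmem, hv₀]; norm_num
  have H8 : ∀ x : Fin (6 + 6) → Bool, twist γ x = tg → ∀ a b c d : Fin (6 + 6) → Bool, twist γ a = 1 → twist γ b = 1 → twist γ c = 1 →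
      twist γ d = 1 → (8 : ℤ) ∣ ∑ ε : Fin 4 → Bool, sZ (D (fun j => x j ^^ decide (Odd #(univ.filter fun i =>
        ε i && (![a, b, c, d] : Fin 4 → Fin (6 + 6) → Bool) i j)))) := by
    intro x hx a b c d ha hb hc hd
    have hxP : x ∈ P := (hmemP' x).2 hx
    have hdir : ∀ i, (![a, b, c, d] : Fin 4 → Fin (6 + 6) → Bool) i ∈ V := by
      intro i; fin_cases i
      · exact (hVmem a).2 ha
      · exact (hVmem b).2 hb
      · exact (hVmem c).2 hc
      · exact (hVmem d).2 hd
    have hpts : ∀ ε : Fin 4 → Bool, (fun j => x j ^^ decide (Odd #(univ.filter fun i =>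
        ε i && (![a, b, c, d] : Fin 4 → Fin (6 + 6) → Bool) i j))) ∈ P :=
      fun ε => ws_flatPt_mem V hV0 (· ∈ P) hPV 4 x hxP _ hdir ε
    have h5 := hflat5 x (Matrix.vecCons v₀ ![a, b, c, d])
    rw [fr_sum_peel e x v₀ ![a, b, c, d]] at h5
    -- the translated half lies off `P`, where `e = 0`
    have hoffP : ∀ ε : Fin 4 → Bool, bxor (fun j => x j ^^ decide (Odd #(univ.filter fun i =>
        ε i && (![a, b, c, d] : Fin 4 → Fin (6 + 6) → Bool) i j))) v₀ ∉ P := by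
      intro ε hmem
      have h1 := (hmemP' _).1 (hpts ε)
      have h2 := (hmemP' _).1 hmem
      rw [twist_bxor_right, h1, hv₀] at h2
      rcases htg with h | h <;> rw [h] at h2 <;> norm_num at h2
    rw [sum_eq_zero (fun ε _ => he0 _ (fun h => hoffP ε ((hmemP _).2 h))), add_zero,
      sum_congr rfl fun ε _ => hrP _ (hpts ε), sum_add_distrib, ← mul_sum] at h5
    exact (dvd_add_left (dvd_mul_right 8 _)).1 h5
  /- the hyperplane character sums -/
  obtain ⟨m, hm, hpar⟩ := qs_hyperplane_sum_parity D hD γ tg htg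
  have hgran : ∀ y, m y = 0 ∨ |m y| = 16 ∨ |m y| = 32 := gr20_hyperplane_granular_m16 D hD γ hγ0 tg htg H8 m hm
  -- `m ≢ 0` (Parseval for `σ·1_P`)
  have hmne : ∃ y, m y ≠ 0 := by
    by_contra hall
    push Not at hall
    set F : (Fin (6 + 6) → Bool) → ℝ := fun x => if twist γ x = tg then signOf (D x) else 0 with hF
    have hWF : ∀ y, W F y = 64 * (m y : ℝ) := by
      intro y
      rw [← hm y]
      unfold W
      rw [sum_filter]
      refine sum_congr rfl fun x _ => ?_
      simp only [F]
      split_ifs with h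
      · rw [tp_sZ_cast]
      · rw [zero_mul]
    have hpars := sum_W_sq (n := 6 + 6) F
    simp only [hWF, hall, Int.cast_zero, mul_zero] at hpars
    have hF2 : ∑ y, F y ^ 2 = 2048 := by
      have : ∀ y, F y ^ 2 = if twist γ y = tg then (1 : ℝ) else 0 := by
        intro y; simp only [F]; split_ifs with h
        · cases D y <;> simp [signOf]
        · simp
      rw [sum_congr rfl fun y _ => this y, sum_boole, tw59_card_half γ hγ0 tg htg]; norm_num
    rw [hF2] at hpars
    norm_num at hpars
  /- Walsh inversion: the partner's spectrum -/
  have hinv : ∀ y, ∑ x, (u' x : ℝ) * twist x y = 128 * signOf (g y) := by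
    intro y
    have h := tz_inversion (fun y => signOf (g y)) y
    rw [sum_congr rfl fun x _ => by rw [hu' x]] at h
    have h' : (2 : ℝ) ^ 5 * ∑ x, (u' x : ℝ) * twist x y = 2 ^ (6 + 6) * signOf (g y) := by
      rw [mul_sum, ← h]; exact sum_congr rfl fun x _ => by ring
    have e128 : (2 : ℝ) ^ (6 + 6) = 2 ^ 5 * 128 := by norm_num
    rw [e128, mul_assoc] at h'
    exact mul_left_cancel₀ (by positivity) h'
  have hu'form : ∀ x, u' x = 2 * sZ (f x) + (if Odd (u' x) then sZ (D x) + 8 * r x else 0) := by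
    intro x
    by_cases hx : Odd (u' x)
    · rw [if_pos hx]
      have := hrP x ((hmemP x).2 hx)
      simp only [e] at this
      linarith
    · rw [if_neg hx, add_zero]; exact hoff x hx
  have hWf : ∀ y, W (fun x => signOf (f x)) y = 64 * signOf (g y) - 32 * (m y : ℝ) - 4 * ∑ x, (r x : ℝ) * twist x y := by
    intro y
    have h := hinv y
    have hpt : ∀ x, (u' x : ℝ) * twist x y = 2 * (signOf (f x) * twist x y) +
        (if twist γ x = tg then (sZ (D x) : ℝ) * twist x y else 0) + 8 * ((r x : ℝ) * twist x y) := by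
      intro x
      by_cases hx : twist γ x = tg
      · have hxo : Odd (u' x) := (hPg x).2 hx
        rw [if_pos hx, hu'form x, if_pos hxo]; push_cast; rw [tp_sZ_cast]; ring
      · have hxo : ¬ Odd (u' x) := fun h => hx ((hPg x).1 h)
        rw [if_neg hx, hu'form x, if_neg hxo, hroff x (fun hP => hxo ((hmemP x).1 hP))]; push_cast; rw [tp_sZ_cast]; ring
    have hsplit3 : ∑ x, (u' x : ℝ) * twist x y = 2 * ∑ x, signOf (f x) * twist x y +
        ∑ x ∈ univ.filter (fun x : Fin (6 + 6) → Bool => twist γ x = tg), (sZ (D x) : ℝ) * twist x y +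
        8 * ∑ x, (r x : ℝ) * twist x y := by
      rw [sum_congr rfl fun x _ => hpt x, sum_add_distrib, sum_add_distrib, ← mul_sum, ← mul_sum, sum_filter]
    rw [hsplit3, hm y] at h
    unfold W
    linarith
  -- `Φ < 1`: the residual is odd somewhere
  have hΦlt : forrelation f g < 1 := by
    obtain ⟨x₁, hx₁⟩ := hodd
    have h1 : 1 ≤ e x₁ ^ 2 := hsq1 x₁ ((hmemP x₁).2 hx₁)
    have h2 : e x₁ ^ 2 ≤ ∑ x, e x ^ 2 := single_le_sum (f := fun x => e x ^ 2) (fun x _ => sq_nonneg _) (mem_univ x₁)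
    have h3 : (1 : ℝ) ≤ ((∑ x, e x ^ 2 : ℤ) : ℝ) := by exact_mod_cast h1.trans h2
    rw [hBR] at h3
    linarith
  exact ⟨γ, tg, r, m, htg, hγ0, hPg, fun x hx => hroff x (fun hP => hx ((hmemP x).1 hP)), hu'form, hr20, hrabs, hrpars,
    hgran, hmne, hm, hWf, hΦlt⟩

end Summit.QuantumAdvantage.QuantumAdvantage.Theorems.CubicForrelation.NearExactIsExact

end
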